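import Mathlib
import HarnessLib

/-!
# THEOREM Λ with the recursion hypothesis restricted to positive levels (self-contained)

Support file for the Sahi / Conjecture-P programme of route `PercNearOneGluingNoHeavy`
(`--supports stmt-CriticalPhenomena-4575`, prover prim-l12-p5 gen 48; proof note
`prim-l12-p5/PROOF-DIFFERENCE-HURWITZ-g48.md` §1, §4).  No definitions, no named facts, no sorries.

`FallingMesh.fallingMesh_roots` (file `…FallingMesh`) asks for the recursion
`C q · P_{T+1}^{(q)} = (C q + X) P_T^{(q+1)} - C(1-g_T)·X·P_T^{(q+1)}(X-1)` at EVERY real `q`; at `q = 0` its left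
side vanishes, which forces `g_0 = 0` — that statement is vacuous.  The falling-factorial family
`P_T^{(q)} = Σ_j e_j(g) X(X-1)⋯(X-j+1)/(q)_j` satisfies the recursion for `q > 0`
(`FallingMesh.closedForm_rec`, file `…FallingClosedForm`), and the proof of THEOREM Λ only uses positive
levels.  `FallingMesh.fallingMesh_roots_pos` below is THEOREM Λ with the hypothesis restricted to `q > 0`:
for `0 < g_t < 1`, `q > 0`: `P_T^{(q)} = C lc · ∏_{i<T}(X - C r_i)`, `lc > 0`, `r_i < -q`, `r_i + 1 < r_{i+1}`.
(The root-location tools of `…FallingMesh` are re-derived locally inside the proof because that module's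
compiled interface is not yet available to importers.)
-/

namespace Summit.CriticalPhenomena.PercolationContinuityZ3.Theorems

namespace FallingMesh

open Finset Polynomial

/-- **THEOREM Λ** (usable form: recursion for `q > 0`).  Let `P : ℕ → ℝ → ℝ[X]` satisfy `P 0 q = 1` and,
for every `q > 0`, `C q · P (t+1) q = (C q + X) · P t (q+1) - C (1 - g t) · (X · (P t (q+1)).comp (X - 1))`
with `0 < g t < 1`.  Then for every `T` and `q > 0`: `P T q = C lc · ∏_{i<T} (X - C r_i)` with `lc > 0`,
`r_i < -q` and `r_i + 1 < r_{i+1}`. -/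
theorem fallingMesh_roots_pos (P : ℕ → ℝ → ℝ[X]) (g : ℕ → ℝ) (hg : ∀ t, 0 < g t ∧ g t < 1)
    (hP0 : ∀ q, P 0 q = 1)
    (hPs : ∀ t q, 0 < q → C q * P (t + 1) q =
      (C q + X) * P t (q + 1) - C (1 - g t) * (X * (P t (q + 1)).comp (X - C 1))) :
    ∀ (T : ℕ) (q : ℝ), 0 < q → ∃ (lc : ℝ) (r : ℕ → ℝ), 0 < lc ∧
      (∀ i, i < T → r i < -q) ∧ (∀ i, i + 1 < T → r i + 1 < r (i + 1)) ∧
      P T q = C lc * ∏ i ∈ range T, (X - C (r i)) := by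
  have sign_prod : ∀ (k m : ℕ) (α : ℕ → ℝ) (x : ℝ), m ≤ k →
      (∀ i, i + m < k → α i < x) → (∀ i, k ≤ i + m → i < k → x < α i) →
      0 < (-1 : ℝ) ^ m * ∏ i ∈ range k, (x - α i) := by
    intro k
    induction k with
    | zero => intro m α x hm _ _; rw [show m = 0 by omega]; simp
    | succ k ih =>
      intro m α x hm hlo hhi
      rw [prod_range_succ]
      rcases Nat.eq_zero_or_pos m with hm0 | hm0
      · subst hm0
        have hlast : α k < x := hlo _ (by omega)
        have h1 := ih 0 α x (Nat.zero_le _) (fun i _ => hlo _ (by omega)) (fun i hi _ => absurd hi (by omega))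
        simp only [pow_zero, one_mul] at h1 ⊢
        exact mul_pos h1 (by linarith)
      · have hlast : x < α k := hhi _ (by omega) (by omega)
        have h1 := ih (m - 1) α x (by omega) (fun i hi => hlo _ (by omega)) (fun i hi hi' => hhi _ (by omega) (by omega))
        have hpow : (-1 : ℝ) ^ m = (-1) ^ (m - 1) * (-1) := by
          rw [← pow_succ, Nat.sub_add_cancel hm0]
        rw [hpow]
        have : (-1 : ℝ) ^ (m - 1) * -1 * ((∏ i ∈ range k, (x - α i)) * (x - α k))
            = ((-1 : ℝ) ^ (m - 1) * ∏ i ∈ range k, (x - α i)) * (α k - x) := by ring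
        rw [this]
        exact mul_pos h1 (by linarith)
  have eq_prod_of_roots : ∀ (k : ℕ) (f : ℝ[X]), f.degree ≤ k → ∀ (x : ℕ → ℝ),
      (∀ i j, i < j → j < k → x i < x j) → (∀ j, j < k → f.eval (x j) = 0) → ∀ (x₀ : ℝ),
      (∀ j, j < k → x j < x₀) →
      f = C (f.eval x₀ / ∏ j ∈ range k, (x₀ - x j)) * ∏ j ∈ range k, (X - C (x j)) := by
    intro k f hf x hx hroot x₀ hx₀
    have hprod_pos : 0 < ∏ j ∈ range k, (x₀ - x j) :=
      prod_pos fun j hj => by rw [mem_range] at hj; linarith [hx₀ j hj]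
    let v : ℕ → ℝ := fun j => if j < k then x j else x₀
    have hv_inj : Set.InjOn v (range (k + 1) : Finset ℕ) := by
      intro a ha b hb hab
      simp only [coe_range, Set.mem_Iio] at ha hb
      have key : ∀ a b : ℕ, a < k + 1 → b < k + 1 → v a = v b → a ≤ b := by
        intro a b ha hb hab
        refine le_of_not_gt fun hlt => ?_
        by_cases hak : a < k
        · have hbk : b < k := by omega
          simp only [v, if_pos hak, if_pos hbk] at hab
          linarith [hx b a hlt hak]
        · have hbk : b < k := by omega
          simp only [v, if_neg hak, if_pos hbk] at hab
          linarith [hx₀ b hbk]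
      exact le_antisymm (key a b ha hb hab) (key b a hb ha hab.symm)
    have hcard : #(range (k + 1)) = k + 1 := card_range _
    apply eq_of_degrees_lt_of_eval_index_eq (v := v) (s := range (k + 1)) hv_inj
    · rw [hcard]; exact lt_of_le_of_lt hf (by exact_mod_cast Nat.lt_succ_self k)
    · rw [hcard, ← smul_eq_C_mul]
      refine lt_of_le_of_lt (degree_smul_le _ _) ?_
      rw [degree_prod]
      simp only [degree_X_sub_C, sum_const, card_range, nsmul_eq_mul, mul_one]
      exact_mod_cast Nat.lt_succ_self k
    · intro i hi
      rw [mem_range] at hi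
      by_cases hik : i < k
      · have hvi : v i = x i := if_pos hik
        rw [hvi, hroot i hik, eval_mul, eval_prod,
          prod_eq_zero (f := fun j => eval (x i) (X - C (x j))) (mem_range.2 hik)
            (by rw [eval_sub, eval_X, eval_C, sub_self]), mul_zero]
      · have hvi : v i = x₀ := if_neg hik
        rw [hvi, eval_mul, eval_C, eval_prod]
        simp only [eval_sub, eval_X, eval_C]
        rw [div_mul_cancel₀ _ (ne_of_gt hprod_pos)]
  have exists_root_of_sign_change : ∀ (f : ℝ → ℝ), Continuous f → ∀ (a b : ℝ), a < b →
      f a * f b < 0 → ∃ c, a < c ∧ c < b ∧ f c = 0 := by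
    intro f hf a b hab h
    rcases lt_or_gt_of_ne (show f a ≠ 0 from fun h0 => by rw [h0, zero_mul] at h; exact lt_irrefl _ h)
      with ha | ha
    · have hb : 0 < f b := by nlinarith
      obtain ⟨c, hc, hc0⟩ := intermediate_value_Ioo hab.le hf.continuousOn ⟨ha, hb⟩
      exact ⟨c, hc.1, hc.2, hc0⟩
    · have hb : f b < 0 := by nlinarith
      obtain ⟨c, hc, hc0⟩ := intermediate_value_Ioo' hab.le hf.continuousOn ⟨hb, ha⟩
      exact ⟨c, hc.1, hc.2, hc0⟩
  have prodForm_natDegree : ∀ (a : ℝ), a ≠ 0 → ∀ (r : ℕ → ℝ) (n : ℕ),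
      (C a * ∏ i ∈ range n, (X - C (r i))).natDegree = n ∧
      (C a * ∏ i ∈ range n, (X - C (r i))).leadingCoeff = a := by
    intro a ha r n
    have hmon : (∏ i ∈ range n, (X - C (r i))).Monic := monic_prod_of_monic _ _ fun i _ => monic_X_sub_C _
    have hnd : (∏ i ∈ range n, (X - C (r i))).natDegree = n := by
      rw [natDegree_prod _ _ fun i _ => X_sub_C_ne_zero _]
      simp
    refine ⟨by rw [natDegree_C_mul ha, hnd], by rw [leadingCoeff_mul, leadingCoeff_C, hmon.leadingCoeff, mul_one]⟩
  have prodForm_eval : ∀ (a : ℝ) (r : ℕ → ℝ) (n : ℕ) (y : ℝ),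
      (C a * ∏ i ∈ range n, (X - C (r i))).eval y = a * ∏ i ∈ range n, (y - r i) := by
    intro a r n y
    rw [eval_mul, eval_C, eval_prod]
    simp only [eval_sub, eval_X, eval_C]
  intro T
  induction T with
  | zero =>
    intro q hq
    exact ⟨1, fun _ => 0, one_pos, fun i hi => absurd hi (by omega), fun i hi => absurd hi (by omega),
      by rw [hP0, prod_range_zero, mul_one, C_1]⟩
  | succ n ih =>
    intro q hq
    obtain ⟨lc, r, hlc, hrq, hgap, hQ⟩ := ih (q + 1) (by linarith)
    set h : ℝ := 1 - g n with hh
    have hh0 : 0 < h := by rw [hh]; linarith [(hg n).2]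
    have hh1 : h < 1 := by rw [hh]; linarith [(hg n).1]
    set Q := P n (q + 1) with hQdef
    set F : ℝ[X] := (C q + X) * Q - C h * (X * Q.comp (X - C 1)) with hF
    have hPF : P (n + 1) q = C q⁻¹ * F := by
      have h1 : C q * P (n + 1) q = F := by rw [hF, hh]; exact hPs n q hq
      rw [← h1, ← mul_assoc, ← C_mul, inv_mul_cancel₀ (ne_of_gt hq), C_1, one_mul]
    -- sorted roots: r i < r j for i < j < n
    have hmono : ∀ i j, i < j → j < n → r i + 1 < r j := by
      intro i j hij hjn
      induction j with
      | zero => exact absurd hij (by omega)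
      | succ j ihj =>
        rcases Nat.lt_or_ge i j with h' | h'
        · have := ihj h' (by omega); have := hgap j hjn; linarith
        · have : i = j := by omega
          subst this; exact hgap i hjn
    -- evaluation of F
    have hevF : ∀ y : ℝ, F.eval y = (q + y) * (lc * ∏ i ∈ range n, (y - r i))
        - h * (y * (lc * ∏ i ∈ range n, (y - 1 - r i))) := by
      intro y
      simp only [hF, eval_sub, eval_mul, eval_add, eval_C, eval_X, eval_comp]
      rw [hQ, prodForm_eval, prodForm_eval]
    -- (a) sign at r_i: (-1)^(n-i) F(r_i) > 0
    have hsa : ∀ i, i < n → 0 < (-1 : ℝ) ^ (n - i) * F.eval (r i) := by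
      intro i hi
      have hz : ∏ j ∈ range n, (r i - r j) = 0 :=
        prod_eq_zero (mem_range.2 hi) (sub_self _)
      have hs := sign_prod n (n - i) (fun j => r j) (r i - 1) (by omega)
        (fun j hj => by have := hmono j i (by omega) hi; linarith)
        (fun j hj hj' => by
          rcases Nat.lt_or_ge i j with h' | h'
          · have := hmono i j h' hj'; linarith
          · have : j = i := by omega
            subst this; linarith)
      rw [hevF, hz, mul_zero, mul_zero, zero_sub]
      have hri : r i < 0 := by linarith [hrq i hi]
      have e : (-1 : ℝ) ^ (n - i) * -(h * (r i * (lc * ∏ j ∈ range n, (r i - 1 - r j))))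
          = (h * (-r i) * lc) * ((-1 : ℝ) ^ (n - i) * ∏ j ∈ range n, (r i - 1 - r j)) := by ring
      rw [e]
      exact mul_pos (mul_pos (mul_pos hh0 (by linarith)) hlc) hs
    -- (b) sign at r_i + 1: (-1)^(n-i) F(r_i + 1) > 0
    have hsb : ∀ i, i < n → 0 < (-1 : ℝ) ^ (n - i) * F.eval (r i + 1) := by
      intro i hi
      have hz : ∏ j ∈ range n, (r i + 1 - 1 - r j) = 0 :=
        prod_eq_zero (mem_range.2 hi) (by ring)
      have hs := sign_prod n (n - i - 1) (fun j => r j) (r i + 1) (by omega)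
        (fun j hj => by
          rcases Nat.lt_or_ge j i with h' | h'
          · have := hmono j i h' hi; linarith
          · have : j = i := by omega
            subst this; linarith)
        (fun j hj hj' => by have := hmono i j (by omega) hj'; linarith)
      rw [hevF, hz]
      simp only [mul_zero, sub_zero]
      have hqr : q + (r i + 1) < 0 := by linarith [hrq i hi]
      have hpow : (-1 : ℝ) ^ (n - i) = (-1) ^ (n - i - 1) * (-1) := by
        rw [← pow_succ, show n - i - 1 + 1 = n - i by omega]
      have e : (-1 : ℝ) ^ (n - i) * ((q + (r i + 1)) * (lc * ∏ j ∈ range n, (r i + 1 - r j)))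
          = (-(q + (r i + 1)) * lc) * ((-1 : ℝ) ^ (n - i - 1) * ∏ j ∈ range n, (r i + 1 - r j)) := by
        rw [hpow]; ring
      rw [e]
      exact mul_pos (mul_pos (by linarith) hlc) hs
    -- (c) sign at -q: F(-q) > 0
    have hsc : 0 < F.eval (-q) := by
      have hs := sign_prod n 0 (fun j => r j) (-q - 1) (Nat.zero_le _)
        (fun j hj => by linarith [hrq j (by omega)]) (fun j hj hj' => absurd hj (by omega))
      rw [pow_zero, one_mul] at hs
      rw [hevF, show q + -q = 0 by ring, zero_mul, zero_sub]
      have e : -(h * (-q * (lc * ∏ j ∈ range n, (-q - 1 - r j)))) = (h * q * lc) * ∏ j ∈ range n, (-q - 1 - r j) := by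
        ring
      rw [e]; exact mul_pos (mul_pos (mul_pos hh0 hq) hlc) hs
    -- upper endpoints u_i and sign there: (-1)^(n-i-1) F(u_i) > 0
    set u : ℕ → ℝ := fun i => if i + 1 < n then r (i + 1) else -q with hu
    have hsu : ∀ i, i < n → 0 < (-1 : ℝ) ^ (n - i - 1) * F.eval (u i) := by
      intro i hi
      by_cases h' : i + 1 < n
      · have : u i = r (i + 1) := if_pos h'
        rw [this, show n - i - 1 = n - (i + 1) by omega]; exact hsa (i + 1) h'
      · have : u i = -q := if_neg h'
        rw [this, show n - i - 1 = 0 by omega, pow_zero, one_mul]; exact hsc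
    have hlu : ∀ i, i < n → r i + 1 < u i ∧ u i ≤ -q := by
      intro i hi
      by_cases h' : i + 1 < n
      · rw [show u i = r (i + 1) from if_pos h']
        exact ⟨hgap i h', by linarith [hrq (i + 1) h']⟩
      · rw [show u i = -q from if_neg h']
        exact ⟨by linarith [hrq i hi], le_rfl⟩
    -- the located roots s_i ∈ (r_i + 1, u_i)
    have hex : ∀ i, i < n → ∃ c, r i + 1 < c ∧ c < u i ∧ F.eval c = 0 := by
      intro i hi
      apply exists_root_of_sign_change _ F.continuous _ _ (hlu i hi).1
      have h1 := hsb i hi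
      have h2 := hsu i hi
      rw [show (-1 : ℝ) ^ (n - i) = (-1) ^ (n - i - 1) * (-1) by
        rw [← pow_succ, show n - i - 1 + 1 = n - i by omega]] at h1
      have e : ((-1 : ℝ) ^ (n - i - 1) * -1 * F.eval (r i + 1)) * ((-1 : ℝ) ^ (n - i - 1) * F.eval (u i))
          = -(((-1 : ℝ) ^ (n - i - 1)) ^ 2 * (F.eval (r i + 1) * F.eval (u i))) := by ring
      have h3 := mul_pos h1 h2
      rw [e, show ((-1 : ℝ) ^ (n - i - 1)) ^ 2 = 1 by
        rw [← pow_mul, mul_comm, pow_mul, neg_one_sq, one_pow], one_mul] at h3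
      linarith
    choose! s hs using hex
    have hs1 : ∀ i, i < n → r i + 1 < s i := fun i hi => (hs i hi).1
    have hs3 : ∀ i, i < n → F.eval (s i) = 0 := fun i hi => (hs i hi).2.2
    have hsq : ∀ i, i < n → s i < -q := fun i hi => lt_of_lt_of_le (hs i hi).2.1 (hlu i hi).2
    have hsgap : ∀ i, i + 1 < n → s i + 1 < s (i + 1) := by
      intro i hi
      have h1 : s i < r (i + 1) := by
        have := (hs i (by omega)).2.1; rwa [show u i = r (i + 1) from if_pos hi] at this
      have h2 := hs1 (i + 1) hi
      linarith
    have hsmono : ∀ i j, i < j → j < n → s i < s j := by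
      intro i j hij hjn
      induction j with
      | zero => exact absurd hij (by omega)
      | succ j ihj =>
        rcases Nat.lt_or_ge i j with h' | h'
        · have := ihj h' (by omega); have := hsgap j hjn; linarith
        · have : i = j := by omega
          subst this; have := hsgap i hjn; linarith
    -- degree and leading coefficient of F
    obtain ⟨hQnd, hQlc⟩ := prodForm_natDegree lc (ne_of_gt hlc) r n
    rw [← hQ] at hQnd hQlc
    have hXC : (X - C (1 : ℝ)).natDegree = 1 := natDegree_X_sub_C _
    have hQs_nd : (Q.comp (X - C 1)).natDegree = n := by rw [natDegree_comp, hXC, hQnd, mul_one]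
    have hQs_lc : (Q.comp (X - C 1)).leadingCoeff = lc := by
      rw [leadingCoeff_comp (by rw [hXC]; exact one_ne_zero), hQlc, leadingCoeff_X_sub_C, one_pow, mul_one]
    have hcoefF : F.coeff (n + 1) = (1 - h) * lc := by
      rw [hF, coeff_sub, add_mul, coeff_add, coeff_C_mul, coeff_X_mul, coeff_C_mul, coeff_X_mul,
        coeff_eq_zero_of_natDegree_lt (by rw [hQnd]; exact Nat.lt_succ_self n), mul_zero, zero_add,
        ← hQnd, coeff_natDegree, hQnd, ← hQs_nd, coeff_natDegree, hQs_lc]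
      rw [hQnd] at *
      rw [hQlc]; ring
    have hFnd_le : F.natDegree ≤ n + 1 := by
      rw [hF]
      refine (natDegree_sub_le _ _).trans (max_le ?_ ?_)
      · refine (natDegree_mul_le).trans ?_
        rw [hQnd]
        have : (C q + X : ℝ[X]).natDegree ≤ 1 := by
          rw [add_comm]; exact (natDegree_X_add_C q).le
        omega
      · refine (natDegree_C_mul_le _ _).trans ((natDegree_mul_le).trans ?_)
        rw [hQs_nd, natDegree_X]; omega
    have hlcF : 0 < (1 - h) * lc := mul_pos (by linarith) hlc
    have hFnd : F.natDegree = n + 1 :=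
      natDegree_eq_of_le_of_coeff_ne_zero hFnd_le (by rw [hcoefF]; exact ne_of_gt hlcF)
    have hFlc : F.leadingCoeff = (1 - h) * lc := by rw [leadingCoeff, hFnd, hcoefF]
    have hFne : F ≠ 0 := fun h0 => by rw [h0, natDegree_zero] at hFnd; omega
    -- D := F - lcF · X · ∏ (X - s_j) has degree ≤ n
    set G : ℝ[X] := C ((1 - h) * lc) * (X * ∏ j ∈ range n, (X - C (s j))) with hG
    have hGform : G = C ((1 - h) * lc) * ∏ j ∈ range (n + 1), (X - C (Function.update s n 0 j)) := by
      rw [hG, prod_range_succ, Function.update_self, C_0, sub_zero, mul_comm X]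
      congr 2
      exact prod_congr rfl fun j hj => by rw [Function.update_of_ne (ne_of_lt (mem_range.1 hj))]
    obtain ⟨hGnd, hGlc⟩ := prodForm_natDegree ((1 - h) * lc) (ne_of_gt hlcF) (Function.update s n 0) (n + 1)
    rw [← hGform] at hGnd hGlc
    have hGne : G ≠ 0 := fun h0 => by rw [h0, natDegree_zero] at hGnd; omega
    have hdegF : F.degree = ((n + 1 : ℕ) : WithBot ℕ) := by rw [degree_eq_natDegree hFne, hFnd]
    have hdegG : G.degree = ((n + 1 : ℕ) : WithBot ℕ) := by rw [degree_eq_natDegree hGne, hGnd]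
    have hDdeg : (F - G).degree ≤ n := by
      by_cases hD0 : F - G = 0
      · rw [hD0, degree_zero]; exact bot_le
      · have hlt := degree_sub_lt (hdegF.trans hdegG.symm) hFne (hFlc.trans hGlc.symm)
        have h1 := natDegree_lt_natDegree hD0 hlt
        rw [hFnd] at h1
        exact degree_le_of_natDegree_le (by omega)
    have hDroots : ∀ j, j < n → (F - G).eval (s j) = 0 := by
      intro j hj
      rw [eval_sub, hs3 j hj, hG, eval_mul, eval_mul, eval_prod,
        prod_eq_zero (f := fun i => eval (s j) (X - C (s i))) (mem_range.2 hj)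
          (by rw [eval_sub, eval_X, eval_C, sub_self]), mul_zero, mul_zero, sub_zero]
    have hD := eq_prod_of_roots n (F - G) hDdeg s hsmono hDroots (-q) hsq
    set d : ℝ := (F - G).eval (-q) / ∏ j ∈ range n, (-q - s j) with hd
    -- hence F = ((1-h)lc · X + d) · ∏ (X - s_j)
    have hFfac : F = (C ((1 - h) * lc) * X + C d) * ∏ j ∈ range n, (X - C (s j)) := by
      have : F = (F - G) + G := by ring
      rw [this, hD, hG]; ring
    -- the leftmost zero s* = -d/((1-h)lc) lies below r_0 (n ≥ 1) resp. below -q (n = 0)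
    set sstar : ℝ := -d / ((1 - h) * lc) with hsstar
    have hane : (1 - h) * lc ≠ 0 := ne_of_gt hlcF
    have h1h : (1 - h) ≠ 0 := ne_of_gt (by linarith)
    have hlc0 : lc ≠ 0 := ne_of_gt hlc
    have hasst : (1 - h) * lc * sstar = -d := by
      rw [hsstar]; field_simp
    have hFfac' : F = C ((1 - h) * lc) * ((X - C sstar) * ∏ j ∈ range n, (X - C (s j))) := by
      rw [hFfac]
      have : (C ((1 - h) * lc) * X + C d : ℝ[X]) = C ((1 - h) * lc) * (X - C sstar) := by
        rw [mul_sub, ← C_mul, hasst, C_neg, sub_neg_eq_add]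
      rw [this, mul_assoc]
    have hevF2 : ∀ y, F.eval y = (1 - h) * lc * (y - sstar) * ∏ j ∈ range n, (y - s j) := by
      intro y
      rw [hFfac', eval_mul, eval_C, eval_mul, eval_prod]
      simp only [eval_sub, eval_X, eval_C]
      ring
    have hsstar_lt : ∀ y, (y = -q ∨ (0 < n ∧ y = r 0)) → sstar < y := by
      intro y hy
      -- at such y: (-1)^n F(y) > 0 and (-1)^n ∏ (y - s_j) > 0
      have hFy : 0 < (-1 : ℝ) ^ (if y = -q then 0 else n) * F.eval y := by
        rcases hy with rfl | ⟨hn, rfl⟩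
        · rw [if_pos rfl, pow_zero, one_mul]; exact hsc
        · have hne : r 0 ≠ -q := ne_of_lt (by linarith [hrq 0 hn])
          rw [if_neg hne]
          have := hsa 0 hn
          rwa [Nat.sub_zero] at this
      have hPy : 0 < (-1 : ℝ) ^ (if y = -q then 0 else n) * ∏ j ∈ range n, (y - s j) := by
        rcases hy with rfl | ⟨hn, rfl⟩
        · rw [if_pos rfl]
          exact sign_prod n 0 s (-q) (Nat.zero_le _) (fun j hj => hsq j (by omega))
            (fun j hj hj' => absurd hj (by omega))
        · have hne : r 0 ≠ -q := ne_of_lt (by linarith [hrq 0 hn])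
          rw [if_neg hne]
          exact sign_prod n n s (r 0) le_rfl (fun j hj => absurd hj (by omega))
            (fun j _ hj' => by
              have h1 := hs1 j hj'
              rcases Nat.eq_zero_or_pos j with hj0 | hj0
              · rw [hj0] at h1 ⊢; linarith
              · have := hmono 0 j hj0 hj'; linarith)
      rw [hevF2] at hFy
      have e : (-1 : ℝ) ^ (if y = -q then 0 else n) * ((1 - h) * lc * (y - sstar) * ∏ j ∈ range n, (y - s j))
          = ((1 - h) * lc * (y - sstar)) * ((-1 : ℝ) ^ (if y = -q then 0 else n) * ∏ j ∈ range n, (y - s j)) := by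
        ring
      rw [e] at hFy
      have := pos_of_mul_pos_left hFy hPy.le
      have := (mul_pos_iff_of_pos_left hlcF).1 this
      linarith
    -- assemble the new root vector: s' 0 = s*, s' (i+1) = s i
    refine ⟨(1 - h) * lc / q, fun i => if i = 0 then sstar else s (i - 1), div_pos hlcF hq, ?_, ?_, ?_⟩
    · intro i hi
      dsimp only
      rcases i with _ | i
      · rw [if_pos rfl]; exact hsstar_lt (-q) (Or.inl rfl)
      · rw [if_neg (Nat.succ_ne_zero i), Nat.add_sub_cancel]; exact hsq i (by omega)
    · intro i hi
      dsimp only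
      rcases i with _ | i
      · rw [if_pos rfl, if_neg (by omega), show 0 + 1 - 1 = 0 by omega]
        have h1 := hsstar_lt (r 0) (Or.inr ⟨by omega, rfl⟩)
        have h2 := hs1 0 (by omega)
        linarith
      · rw [if_neg (Nat.succ_ne_zero i), if_neg (by omega), Nat.add_sub_cancel,
          show i + 1 + 1 - 1 = i + 1 by omega]
        exact hsgap i (by omega)
    · dsimp only
      rw [hPF, hFfac', prod_range_succ', ← mul_assoc, ← C_mul, div_eq_inv_mul, if_pos rfl]
      have e1 : ∀ k ∈ range n, (X - C (if k + 1 = 0 then sstar else s (k + 1 - 1)) : ℝ[X]) = X - C (s k) := by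
        intro k _; rw [if_neg (Nat.succ_ne_zero k), Nat.add_sub_cancel]
      rw [prod_congr rfl e1]
      ring

end FallingMesh

end Summit.CriticalPhenomena.PercolationContinuityZ3.Theorems
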